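import Summits.ABC.StewartYu.GenThreeInductionArchWK
import Summits.ABC.StewartYu.GenThreeStepArchW
import HarnessLib

/-!
# Cell abc-stewartyu, WP-L.A shell (parcel P-A1): the Matveev step in the pivot-weighted currency WITH THE
# 2-KUMMER CLAUSE transported (design B's Kummer-conditional core), closed against the regime and the numeric
# record clause

`Summits/ABC/StewartYu/GenThreeStepArchWK.lean` — cell `abc-stewartyu` (HOME `run/shared/lean/pub/abc-stewartyu/`),
route `YuMatveevShapeRat` (rung A1.L, crux r2 `ArchCoreRat`, stmt-ABC-20502), seat p4 (g9), parcel WP-L.A P-A1; the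
Kummer-carrying twin of `GenThreeStepArchW.stepArchW_of_exitC`: the generators come from
`GenThreeStepArchW.exists_step_generators_archW` at `q = 2` (the 2-Kummer clause of the `aⱼ` is transported to
`θᵢ = ∏ aⱼ^{Zᵢⱼ}` because the obstruction lattice is 2-saturated), the numeric heart is the shared
`GenThreeStepArchW.exists_bound_and_cost`.  Theorems only.

WHAT THIS IS NOT: no analytic content; no crux moves.

References: Yu. V. Nesterenko, LNM 1819 (2003), Prop. 2.6 (pp. 57–58), Cor. 4.5 (p. 94); E. M. Matveev, Izv.
Math. 64 (2000), (1.3).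
-/

noncomputable section

open Finset
open Literature.NumberTheory.Transcendental
open Literature.NumberTheory.Transcendental.GaGm

namespace Summit.ABC.StewartYu.GenThreeStepArchWK

open Summit.ABC.StewartYu.GenThreeInductionArch
open Summit.ABC.StewartYu.GenThreeInductionArchW
open Summit.ABC.StewartYu.GenThreeInductionArchWK
open Summit.ABC.StewartYu.GenThreeStepArchW (exists_step_generators_archW exists_bound_and_cost)
open Summit.ABC.StewartYu.GenThreeStepTwo (le_prod_of_one_le)

variable {n r : ℕ}

/-- **The Kummer-carrying pivot-weighted Matveev step from exit C**: as `GenThreeStepArchW.stepArchW_of_exitC`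
with the 2-Kummer clause on the `aⱼ` as an extra input and `StepArchWK` (new generators 2-Kummer) as output.
[cite: Nesterenko2003, Prop 2.6 (2.11)–(2.13) (p. 58), Cor 4.5 (p. 94); Matveev2000, (1.3)] -/
theorem stepArchWK_of_exitC {C : ℕ → ℝ} (hr : 0 < r) (hrn : r < n) (hCr : 0 ≤ C r)
    (a : Fin n → ℚ) (ha : ∀ j, 0 < a j)
    (hind : ∀ μ : Fin n → ℤ, ∏ j, a j ^ μ j = 1 → μ = 0)
    (hK : ∀ κ : Fin n → ℤ, (∃ γ : ℚ, ∏ j, a j ^ κ j = γ ^ 2) → ∀ j, (2 : ℤ) ∣ κ j)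
    (A : Fin n → ℝ) (hA : ∀ j, Height.logHeight₁ (a j) ≤ A j) (hA1 : ∀ j, 1 ≤ A j)
    (b : Fin n → ℤ) {B : ℝ} (k₀ : Fin n) (hk₀ : b k₀ ≠ 0) (hBw : ∀ j, (|b j| : ℝ) * A j ≤ B * A k₀)
    (H : ConnAlgSubgroup n) (M : Fin r → Fin n → ℤ) (hM : LinearIndependent ℤ M)
    (hchars : H.chars = AddSubgroup.closure (Set.range M))
    (hbM : (fun k => (b k : ℚ)) ∈ Submodule.span ℚ (Set.range fun i => fun k => (M i k : ℚ)))
    (hreg : C n * (∏ j, A j) * Real.log (Real.exp 1 * B) < ∑ j, A j * |(b j : ℝ)| + Real.log 2)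
    {Y : ℝ} (hY : 0 < Y) (hYC1 : (r : ℝ) * (n + 1) ≤ Y * C n) (hYC2 : 2 * C r + Y ≤ Y * C n)
    (hcov : ∀ κ : Fin r → Fin n, Function.Injective κ →
      (Matrix.of fun i j => (M j (κ i) : ℝ)).det ≠ 0 →
      ((r.factorial : ℝ)) ^ 2 * (n : ℝ) ^ r *
          (|(Matrix.of fun i j => (M j (κ i) : ℝ)).det| * ∏ i, A (κ i)) * Y ≤ ∏ j, A j) :
    StepArchWK C n a b A B := by
  classical
  have hK2 : ∀ φ : Fin n → ℤ, (∃ γ : ℚ, ∏ j, a j ^ φ j = γ ^ 2) → ∀ j, ((2 : ℕ) : ℤ) ∣ φ j :=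
    fun φ h j => by exact_mod_cast hK φ h j
  obtain ⟨Z, κ, κ', θ, A', m, m₀, i₀, hθ, hA', _hZli, _hZspan, hθpos, hindθ, hKθ, hhA', hA1', hmi₀, hZi₀,
    hm₀, hrel, hκ, hdet, _hmax, hprod, hκ', ⟨i₁, hi₁⟩, hm₀le, hmle⟩ :=
    exists_step_generators_archW 2 (by norm_num) hr a ha hind hK2 A hA hA1 b k₀ hk₀ H M hM hchars hbM
  have hKθ' : ∀ c : Fin r → ℤ, (∃ γ : ℚ, ∏ i, θ i ^ c i = γ ^ 2) → ∀ i, (2 : ℤ) ∣ c i :=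
    fun c h i => by exact_mod_cast hKθ c h i
  have hκ'prod : A k₀ ≤ ∏ i, A (κ' i) := by
    rw [← hi₁]; exact le_prod_of_one_le (fun i => hA1 _) i₁
  have hA'i₀ : A k₀ ≤ A' i₀ := by
    rw [hA' i₀]
    have h1 : A k₀ * |(Z i₀ k₀ : ℝ)| ≤ ∑ j, A j * |(Z i₀ j : ℝ)| :=
      Finset.single_le_sum (f := fun j => A j * |(Z i₀ j : ℝ)|)
        (fun j _ => mul_nonneg (by linarith [hA1 j]) (abs_nonneg _)) (Finset.mem_univ k₀)
    have h2 : (1 : ℝ) ≤ |(Z i₀ k₀ : ℝ)| := by exact_mod_cast Int.one_le_abs hZi₀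
    exact (le_mul_of_one_le_right (by linarith [hA1 k₀]) h2).trans h1
  obtain ⟨B', hB'w, hcost⟩ := exists_bound_and_cost hr hCr hA1 hk₀ hBw hA1' hA'i₀ hm₀ hκ'prod hm₀le
    hmle hprod hreg hY hYC1 hYC2 (hcov κ hκ hdet)
  exact stepArchWK_of_pow_eq ha hrn θ m A' B' i₀ hθpos hindθ hKθ' hhA' hA1' hmi₀ hB'w m₀ hm₀ hrel hcost

end Summit.ABC.StewartYu.GenThreeStepArchWK

end
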